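import Mathlib
import HarnessLib
import HarnessLib.Audit
import Summits.Langlands.Statement
import HarnessLib.Audit.Status.Attr

/-!
Route: TrigonalHeartLimit

# Route TrigonalHeartLimit — six points on a line — KW + Ramakrishnan give the residue of y³ = f₆
for free; it suffices to reach the 3-adic fern at the ramified prime and prove classicality in
singular weight (3,1)

It suffices to show X = TrigonalAutomorphy (+ the junction TrigonalJunction : X → Langlands, the
rest of the summit, filed so that
`closes` ends in the summit constant). X (card trigonal-heart-psl29-transport, conforming re-open of
the retired rev-1 route
TrigonalHeart): for every sextic f ∈ ℤ[x] monic, deg 6, separable, Nat.card Gal(f) = 360 (⇔ Gal =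
A₆), with a non-real root (⇔ exactly two real roots), every ι : ℚ̄₃ ≃ ℂ, σ_K : K = ℚ(ω) → ℂ and
every
ρ : Γ_K → GL₄(ℚ̄₃) COMPATIBLE WITH THE TRIGONAL CURVE C_f : y³ = f(x) (at a.e. v: ρ unramified and
the arithmetic-Frobenius
charpoly is `arithFrobPolyOfSatake ι q_v 1 α` for an α whose power sums are the cubic-character
point counts
−σ_K(Σ_{x∈L} χ_L(f(x)) + 1) = Tr(Frob_L | H¹(C_f)[χ]) — the rev-1 expression, refuter re-derived),
there is an L-algebraic CUSPIDAL π
on GL₄(𝔸_K) with `SatakeFrobCompatibleAt ι π ρ v` a.e. (the summit's own predicate): direction (B)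
for the Deligne–Mostow U(3,1)
motives of six points on a line, Hodge–Tate IRREGULAR (0,1,1,1)/(0,0,0,1). X is reached in two
layers exactly as BCGP reach
abelian surfaces (arXiv:2502.20645 §1.2): residue for free (support: KW(3) + transport +
Ramakrishnan) ⇒ 3-adic limit of
automorphic Galois representations (crux ThreeAdicLimitAutomorphy) ⇒ classical in singular weight
(crux SingularWeightClassicality).
Lean: `TrigonalAutomorphy` (the rank-0 item below; all items elaborate rc 0 in Sketch.lean, and
`closes` is proved there)

## Assembly
Pure logic (proved in Sketch.lean / glue.lean, 8 lines): given f admissible, ι, σ_K, ρ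
trigonal-compatible, GaloisTransport (fed
HeartTwistedTensor) turns any heart-compatible ρ̄ into an odd irreducible τ with the twisted-tensor
charpoly identity;
OddResidualAutomorphyAtThree (Khare–Wintenberger at p = 3, stated in the summit's GL₂ automorphic
idiom) makes τ residually
automorphic of regular weight and RankinSelbergResidualAutomorphy at p = 3 (Ramakrishnan's GL₂ × GL₂
→ GL₄ transfer of residual
automorphy) makes ρ̄ residually automorphic over ℚ in regular weight; that is exactly the
hypothesis of ThreeAdicLimitAutomorphy, whose conclusion is exactly the hypothesis of
SingularWeightClassicality, whose conclusion is
TrigonalAutomorphy for (f, ι, σ_K, ρ); TrigonalJunction carries X to `_root_.Langlands`. glue.lean: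
`theorem closes (hKW :
OddResidualAutomorphyAtThree) (hRS : RankinSelbergResidualAutomorphy) (hH : HeartTwistedTensor) (hG
: GaloisTransport) (hA :
ThreeAdicLimitAutomorphy) (hB : SingularWeightClassicality) (hJ : TrigonalJunction) :
_root_.Langlands` (rc 0, no sorry; last line
`hRS 3 τ ψ χ e ρ̄ hτ hodd (hKW τ hτ hodd) hTTid hirr`). TrigonalGaloisRepExists is a guard, not a
hypothesis.
CONE HYGIENE (rev 1, route-repair 2026-08-15): the route file imports only
`Summits.Langlands.Statement`. The rev-0 support items
SerreWeakFormAtThree / TwistedTensorResidualAutomorphy said the same two things in NEWFORM language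
(coeffCharIntegers, IsNewform1,
IsGaloisRepOfNewform1Int), which forced `import
Literature.NumberTheory.EllipticCurves.NewformGaloisRep` and with it 16 unproved named
facts (Deligne, Deligne–Serre weight one, Eichler–Shimura, new/old-space facts …) into the import
cone — none of them used by the line;
they are superseded 1:1 by OddResidualAutomorphyAtThree / RankinSelbergResidualAutomorphy, typed in
the summit's own automorphic idiom
(RA cuspidal π on GL_n(𝔸_ℚ), O ⊆ ℂ, ι : O → k, HLTT polynomial ∏(X − q^((n−1)/2)α_j) ∈ O[X] reducing
to charpoly of arithmetic
Frobenius a.e. — the idiom the GL₄ clause of ThreeAdicLimitAutomorphy already used). Cruxes and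
target untouched.

Rationale: WHY THIS LINE. Direction (B) for a Hodge–Tate irregular rank-4 motive is open beyond CM/induced
cases; every attack needs (i) residual automorphy
and (ii) a way from the residue to the irregular point. The card makes (i) FREE for the
Zariski-dense family C_f : y³ = f₆(x):
J(C_f)[1−ω] is the heart of the 𝔽₃-permutation module on the six roots (PoonenSchaefer1997), A₆ ≅
PSL₂(9) ≅ Ω₄⁻(3) makes it the
twisted tensor square W ⊗ W^(3) (Gorenstein1982, JamesKerber1981), complex conjugation is a double
transposition so the Tate lift
τ̃ is odd, and Khare–Wintenberger (tree fact `exists_newform_of_odd_irreducible`, p = 3) +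
weight-separated Deligne–Serre lifts +
Ramakrishnan2000 (GL₂×GL₂→GL₄) give residual automorphy in REGULAR weight with no p–q switch and no
Moret-Bailly. For (ii) this
route transplants the two-step architecture BCGP print for abelian surfaces
(BoxerCalegariGeePilloni2025 §1.2–1.3: lifting ⇒ a
p-adic form of irregular weight; then Pan-style classicality, Sen = Cousin, using BoxerPilloni2021
higher Coleman theory and p-adic
Eichler–Shimura) to GU(3,1)_{ℚ(ω)/ℚ} at the RAMIFIED prime 3, typed technology-free at the GL₄ level
in the idiom of the tree's
`IsOrdinaryPolarizedAutomorphicLimit` (uniform 3-adic trace limits of lang.S27 data;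
HellmannMargerinSchraen2022 / Chenevier2011 ferns
are the expected engine of the first step). Imported: modular representation theory of S₆ and the
exceptional isomorphism (finite
groups), Serre's conjecture over ℚ, Rankin–Selberg functoriality, eigenvariety density, locally
analytic completed cohomology. What
it does that the retired rev-1 route did not: `closes` decides `_root_.Langlands` (junction), the
monolithic IrregularLifting is cut at
its natural joint into two genuinely open, separately refutable cruxes (limit / classicality), the
target is in the summit's own
Satake–Frobenius predicate, and KW(3) is an explicit item instead of a hidden hypothesis; negatives
index (1 entry, K3 Kuga–Satake
SerreTypeAnchor) untouched.

RANKED CRUXES. #0 TrigonalAutomorphy (target) — X as in § Thesis: for f admissible (f ∈ ℤ[x] monic,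
deg 6, separable, Nat.card Gal(f) = 360 (⇔ Gal = A₆), with a non-real root (⇔ exactly two real
roots)), ι, σ_K and ρ : Γ_K → GL₄(ℚ̄₃) trigonal-compatible with f (a.e. v: unramified, Frobenius
charpoly arithFrobPolyOfSatake ι q_v 1 α with Σ_j α_j^[L:k_v] = −σ_K(Σ_{x∈L} χ_L(f(x)) + 1) for
every finite L ⊇ k_v, χ_L(u) = the ζ ∈ μ₃(𝓞_K) lifting u^((|L|−1)/3)), there is an L-algebraic
cuspidal π on GL₄(𝔸_K), K = CyclotomicField 3 ℚ, with SatakeFrobCompatibleAt ι π ρ v for a.e. v. By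
Chebotarev + Brauer–Nesbitt such ρ are exactly the ρ ≅ ρ_{f,χ} = H¹_et(C_f, ℚ̄₃)[χ] (irreducible
since Gal = A₆ acts absolutely irreducibly on the heart), so X is direction (B) for these motives;
non-vacuity is the support item TrigonalGaloisRepExists. (why it might fail: False only if
reciprocity fails for H¹(C_f)[χ]/ℚ(ω); as TYPED it can fail by normalisation alone (sign/+1 of the
cubic sum, σ_K↔piece, m = 1 L-normalisation, arithmetic vs geometric Frobenius) — counts checked at
p = 7, 13 for three sextics (rev 1) and re-derived by a refuter.) [BuzzardGeeLMS2014,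
DeligneMostow1986, PoonenSchaefer1997, Looijenga2023,
Summits/Langlands/Langlands/Ideas/trigonal-heart-psl29-transport.md]
#2 SingularWeightClassicality (crux) — CLASSICALITY AT THE SINGULAR WEIGHT (card T3 + the U(3,1)
half of T2; BCGP 2025 Thm 'multiplicity-one-implies-classical' transplanted): for f admissible, ι,
σ_K and ρ trigonal-compatible with f, IF ρ is a uniform 3-adic limit of automorphic Galois
representations over K (∀ M ∃ regular algebraic cuspidal Π_M on GL₄(𝔸_K) and r_M : Γ_K → GL₄(ℚ̄₃)
attached to Π_M in the lang.S27 shape at every v ∤ 3, with ‖tr r_M(σ) − tr ρ(σ)‖ ≤ 3^−M for all σ),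
THEN ρ is automorphic: an L-algebraic cuspidal π on GL₄(𝔸_K) with SatakeFrobCompatibleAt ι π ρ v
a.e. Mechanism foreseen: ρ is de Rham with HT (0,1,1,1)/(0,0,0,1) (H¹ of a curve), sits on the
eigenvariety of the definite U(4) or of the Deligne–Mostow ball quotient U(3,1) (moduli of six
points, Looijenga2023); p-adic Jacquet–Langlands to U(3,1); higher Coleman theory + p-adic
Eichler–Shimura realise ρ in completed coherent cohomology of singular weight; Sen operator = Cousin
map ⇒ de Rham forces classicality (Pan2022LocallyAnalytic, BoxerCalegariGeePilloni2025 §1.3);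
transfer U(3,1) → GL₄/K (Mok2014). [deps: ThreeAdicLimitAutomorphy] [difficulty: open-problem] (why
it might fail: HT (0,1,1,1) is singular: no definite-U(4) classical form has this weight, so
classicality must run through coherent cohomology of the U(3,1) ball quotient (higher Coleman,
p-adic Eichler–Shimura, Sen = Cousin) at p = 3 RAMIFIED in K, likely non-ordinary at λ; known only
for GSp4/ℚ ordinary.) [BoxerCalegariGeePilloni2025, arXiv:2502.20645, Pan2022LocallyAnalytic,
BoxerPilloni2021, BoxerEtAl2021, Pilloni2020, Mok2014,
Literature.Barriers.Langlands.NonRegularWeightBarrier]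
#3 ThreeAdicLimitAutomorphy (crux) — THE 3-ADIC FERN AT THE RAMIFIED PRIME (card T2, output form; 'R
= T' half of BCGP's architecture): for f admissible, IF every heart-compatible ρ̄ : G_ℚ → GL₄(k) (k
alg. closed, char 3, discrete; charpoly ρ̄(σ)·(X−1)² = charpoly of σ permuting the six roots) is
residually automorphic over ℚ in regular weight (the conclusion of RankinSelbergResidualAutomorphy
verbatim: a regular algebraic cuspidal Π_ℚ on GL₄(𝔸_ℚ), O ⊆ ℂ, ι : O → k reducing its Hecke
polynomials ∏(X − q^(3/2)α_j) onto charpoly ρ̄(Frob_v) a.e.), THEN every ρ : Γ_K → GL₄(ℚ̄₃)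
trigonal-compatible with f is a uniform 3-adic limit of automorphic Galois representations over K =
ℚ(ω) (∀ M ∃ RA cuspidal Π_M on GL₄(𝔸_K), r_M attached in the lang.S27 shape at all v ∤ 3, ‖tr r_M −
tr ρ‖ ≤ 3^−M on Γ_K). Route inside: reduce ρ (point counts mod λ give ρ̄|_K^ss ≅ heart|_K,
elementary: −(S_v+1) ≡ #roots − 2 mod λ), base-change Π_ℚ to K (ArthurClozelAMS120), descend to a
unitary group, put ρ on the eigenvariety by an R = T / infinite-fern density theorem (Chenevier2011,
HellmannMargerinSchraen2022, BreuilHellmannSchraen2017Trianguline) and approximate by classical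
points of regular weight and small slope. [deps: RankinSelbergResidualAutomorphy, GaloisTransport,
HeartTwistedTensor, OddResidualAutomorphyAtThree] [difficulty: open-problem] (why it might fail:
Needs 'R = T on the eigenvariety' at p = 3 where ζ₃ ∈ K (μ_p ⊂ F obstructs Taylor–Wiles primes, cf.
p = 2 over ℚ), U(4)_K/ℚ is ramified at 3, ρ_f,λ is typically NON-ordinary (Artin–Schreier reduction
at 3), and 3 ∣ #A₆ (adequacy of the heart unverified; H¹(SL₂(9), ·) is exceptional).)
[HellmannMargerinSchraen2022, Chenevier2011, BreuilHellmannSchraen2017Trianguline,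
BellaicheChenevier2009, Thorne2012, GuralnickHerzigTiep2017, Kisin2009TwoAdic, BarnetlambEtAl2014,
ArthurClozelAMS120, AndersenJorgensenLandrock1983]
#9 RankinSelbergResidualAutomorphy (support) — THE ENGINE: RANKIN–SELBERG TRANSFER OF RESIDUAL
AUTOMORPHY GL₂ → GL₄ (known in print, hence support; rev 1 supersedes rev-0
TwistedTensorResidualAutomorphy: same conclusion verbatim, the blanket Serre hypothesis in newform
language replaced by the POINTWISE residual automorphy of τ in the summit's idiom): for every prime
p and alg. closed discrete k of char p, if τ : G_ℚ → GL₂(k) is irreducible, odd and residually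
automorphic of regular weight (∃ RA cuspidal π on GL₂(𝔸_ℚ), O ⊆ ℂ, ι : O → k with ∏(X − q^(1/2)α_j)
∈ O[X] reducing along ι to charpoly τ(Frob_v) a.e.), ψ : k →+* k, χ a character, e : Fin 2 × Fin 2 ≃
Fin 4 and ρ̄ : G_ℚ → GL₄(k) is irreducible with charpoly ρ̄(σ) = charpoly(reindex_e(det χ(σ)·τ(σ) ⊗
τ(σ)^ψ)) for all σ, then ρ̄ is residually automorphic on GL₄/ℚ in regular weight (∃ RA cuspidal Π,
O′ ⊆ ℂ, ι′ : O′ → k with ι′(∏(X − q^(3/2)α_j)) = charpoly ρ̄(Frob_v) a.e.). In print: π ↔ newform g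
of weight w ≥ 2 (RA cuspidal on GL₂/ℚ ⇔ holomorphic of weight ≥ 2); τ^ψ is attached to the same g
along ψ ∘ ι; weight separation g′ ≡ g (mod p) of weight w′ = w + m(p−1) ≠ w by Hasse-invariant
multiplication (E_(p−1); E₄ for p = 2, 3) + Deligne–Serre lifting (DeligneSerreASENS1974 Lemme
6.11); χ ↦ Teichmüller lift ↦ finite-order Hecke character; Π = (g ⊠ g′) ⊗ χ̃ (Ramakrishnan2000 Thm
M), cuspidal since g′ is no twist of g (w′ ≠ w) — equivalently since ρ̄ is irreducible —, regular
algebraic since HT = {0, w−1, w′−1, w+w′−2} is multiplicity-free, brought to the HLTT convention by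
an integral |det|-twist / contragredient. [difficulty: L] [Ramakrishnan2000, DeligneSerreASENS1974,
KhareWintenberger2009, Dieulefait2020, Ramakrishnan2002]
#9 HeartTwistedTensor (support) — THE TRANSPORT, finite and decidable (rev-1 r4 verbatim): ∃ φ :
SL₂(𝔽₉) →* S₆ with image A₆, ψ ≠ id a ring endomorphism of 𝔽₉, e : Fin 2 × Fin 2 ≃ Fin 4 and
invertible P ∈ M₄(𝔽₉) with M(φ g)·P = P·reindex_e(g ⊗ g^ψ) for all g, where M(σ) is the explicit
matrix of σ on the heart (sum-zero/constants) of 𝔽₃[six points] in the basis [e_j − e_5]. A₆ ≅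
PSL₂(9) ≅ Ω₄⁻(3); heart = D^(5,1) = W ⊗ W^(3) (James1978 Ex. 5.1/17.1, Gorenstein1982 (2.7)).
Certified computation or character theory. [difficulty: provable-now] [JamesKerber1981, James1978,
Mortimer1980, Gorenstein1982]
#9 GaloisTransport (support) — GALOIS TRANSPORT (rev-1 r5 verbatim): HeartTwistedTensor ⟹ for f
admissible and every heart-compatible ρ̄ : G_ℚ → GL₄(k) there are τ : G_ℚ → GL₂(k) irreducible and
ODD, ψ : k →+* k, χ, e with charpoly ρ̄(σ) = charpoly(reindex_e(det χ(σ)·τ(σ) ⊗ τ(σ)^ψ)) for all σ,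
and ρ̄ is irreducible. Tate lifting of G_ℚ → A₆ ≅ PSL₂(9) → PGL₂(k) (SerreDurham1977 §6, H²(G_ℚ,
k^×)-lifting); oddness: c² = 1 forces τ̃(c) = ±i·g with g² = −1, eigenvalues ±1, det = −1, as soon
as c moves a root. [difficulty: M] [SerreDurham1977, Buhler1978, KhareWintenberger2009,
JamesKerber1981]
#9 OddResidualAutomorphyAtThree (support) — SERRE'S CONJECTURE AT p = 3 IN THE SUMMIT'S AUTOMORPHIC
IDIOM (theorem of Khare–Wintenberger–Kisin; rev 1 supersedes rev-0 SerreWeakFormAtThree, which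
inlined the newform-language body of the tree fact
`Literature.NumberTheory.Automorphic.exists_newform_of_odd_irreducible (p := 3)` and thereby forced
the NewformGaloisRep import): for k alg. closed of characteristic 3, discrete, every irreducible ODD
τ : G_ℚ → GL₂(k) is residually automorphic of regular weight: ∃ RA cuspidal π on GL₂(𝔸_ℚ), O ⊆ ℂ, ι
: O →+* k such that for a.e. v the HLTT polynomial ∏_j(X − q_v^(1/2)α_j) (α the Satake parameter of
π_v) lies in O[X] and reduces along ι to charpoly τ(Frob_v) (arithmetic Frobenius) — verbatim the
hypothesis RankinSelbergResidualAutomorphy consumes, n = 2 in place of 4. In print: KW(3) gives a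
newform g ∈ S_w(Γ₁(N)), w = k(τ) ≥ 2, with ρ̄_g ≅ τ; π = the automorphic representation of g twisted
by the integral power of |det| making it C-algebraic with HLTT numbers the roots of X² − a_q X +
ε(q)q^(w−1) (contragredient if the Frobenius convention demands), O = 𝓞_(K_g), ι = reduction at a
prime above 3. KW(3) stays the named unproved theorem the free residue rests on (instruction), now
NOT imported: the item closes when KW(3) and the newform → CuspidalAutomorphicRepData 2 ℚ dictionary
land in the tree. [difficulty: XL] [KhareWintenberger2009, Kisin2009TwoAdic, DeligneSerreASENS1974]
#9 TrigonalGaloisRepExists (support) — NON-VACUITY GUARD (not a hypothesis of closes; known: Weil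
1948 + Tate module + the ℤ[ω]-isotypic decomposition of H¹_et(C_f, ℚ̄₃) over K): for every monic
separable sextic f ∈ ℤ[x], ι and σ_K there is a ρ : Γ_K → GL₄(ℚ̄₃) trigonal-compatible with f (same
clause as in the target). A refuter who finds the clause unsatisfiable for one f (numerically: power
sums at p = 7, 13, 19 not those of a weight-1 rank-4 Frobenius) has found a normalisation slip in
the whole route — restate, do not close. [difficulty: XL] [PoonenSchaefer1997, DeligneMostow1986,
Sutherland2012]
#9 TrigonalJunction (support) — THE REST OF THE SUMMIT: automorphy of the trigonal U(3,1) family (X)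
⇒ Langlands (all other n, F, ρ, direction (A), local–global compatibility at every place, upgrade of
a.e. Satake matching to Corresponds). Not this route's business; filed so that `closes` ends in the
summit constant (house pattern of the conforming routes, e.g. ImQuadArtinJunction); shared junction
for the three μ₃-cover ball-quotient cards (Picard U(2,1), this U(3,1), cubic surfaces U(4,1)) once
their targets are typed in the same Satake–Frobenius form. [difficulty: open-problem]
[BuzzardGeeLMS2014, FontaineMazurGeometric1995]

TWO-LAYER PLAN. ThreeAdicLimitAutomorphy ⇐ HeartResidueOverK (point counts mod λ + base change +
unitary descent: ρ̄|_K automorphic on U(4), provable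
from tree facts) → FernDensity (every trianguline-at-λ polarized lift of an automorphic adequate ρ̄
over K lies on the eigenvariety:
HMS/Chenevier-type R = T) → ThreeAdicLimitAutomorphy (k = 2; filed when a prover asks; if the
ramified unitary group at 3 blocks
patching over K, the resplit works over the solvable CM extension L = K(√6), in which the place over
3 splits in L/L⁺, and folds
cyclic descent L → K into the glue). SingularWeightClassicality ⇐ OverconvergentOnBallQuotient
(p-adic Jacquet–Langlands: the limit
point is an overconvergent eigenform of singular weight (3,1) on the Deligne–Mostow ball quotient,
higher Coleman theory at ramified 3)
→ SenEqualsCousin (de Rham ⇒ classical in that weight; BCGP 2025 §1.3 for U(3,1)) →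
SingularWeightClassicality (k = 2). Support
foreseen under the fern: HeartAdequate (Thorne adequacy / H¹(A₆, ad⁰ heart) = 0 over 𝔽̄₃ —
decidable; filed informal at open with a
definition request) and TorsionIsHeart (J(C_f)[1−ω] ≅ heart, PoonenSchaefer1997; informal, documents
why the cruxes are LIFTING statements).

KILL CRITERIA. (a) HeartTwistedTensor refuted by computation (no φ, P, ψ, e) ⇒ the transport is
wrong: close refuted:HeartTwistedTensor unless the fix
is a re-indexing (restate). (b) GaloisTransport refuted (an admissible f with a heart-compatible ρ̄
whose τ is even, or ρ̄ reducible)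
⇒ the free residue is gone: close. (c) TrigonalGaloisRepExists shown unsatisfiable for one f, or the
target refuted at one (f, v) by
point counting against a PROVED instance ⇒ normalisation slip: restate target + both cruxes
(misstated), not a close. (d)
ThreeAdicLimitAutomorphy refuted substantively (e.g. a trigonal ρ provably off every U(4)/U(3,1)
eigenvariety of tame level prime to
3·disc f) ⇒ pivot to the L = K(√6) resplit; if that dies too, close refuted. (e)
SingularWeightClassicality is shared fate with the
NonRegularWeightBarrier: not refutable in finite time short of ¬Langlands; if
ThreeAdicLimitAutomorphy closes and no singular-weight
technology for unitary ball quotients appears within tenure, the route goes DORMANT with the limit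
theorem as its output. (f) A proof
elsewhere of (B) for all irregular polarized rank-4 ρ over CM fields moots the route (superseded).
(g) OddResidualAutomorphyAtThree and RankinSelbergResidualAutomorphy are theorems in print: a
refutation of either AS TYPED is a normalisation slip (HLTT shift q^((n−1)/2), arithmetic vs
geometric Frobenius, choice of O/ι) ⇒ restate (misstated), never a close.

NOT DECOMPOSED YET. The fern's interior (which unitary group; ordinary vs finite slope at λ — the
Newton polygon of J(C_f) at the Artin–Schreier prime is
generically NOT ordinary, so μ-ordinary/finite-slope is the expected regime; adequacy at p = 3; the
ζ₃ ∈ K Taylor–Wiles nuisance; the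
L = K(√6) variant), the classicality interior (higher Coleman theory on the ball quotient at a
ramified prime, p-adic Eichler–Shimura in
weight (3,1), Sen = Cousin, Mok transfer), local–global compatibility of the output π at λ and 2,
the A₅ configurations (transitive
sextic A₅ ≅ PSL₂(5); quintic × linear) running on the same engine, and the conditional
non-square-discriminant branch (Serre over real
quadratic fields + Asai) — all layer 2 or later routes. Cite items wanted (not cruxes): Ramakrishnan
GL₂×GL₂→GL₄ with cuspidality
criterion; Deligne–Serre lifting lemma in weight ≥ 2; newform adelisation GL₂/ℚ →
CuspidalAutomorphicRepData 2 ℚ.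

CHEAPEST FALSIFIER. Run first (an afternoon, GAP/Magma or Lean `decide` on 𝔽₉-matrices): (1)
HeartTwistedTensor — enumerate φ : SL₂(𝔽₉) ↠ A₆ (one class up
to Aut), ψ = Frobenius, and solve the linear system M(φ g)P = P(g ⊗ g^ψ) on generators; no
invertible P ⇒ kill (a). (2) For f = x⁶+x+1-type
sextics with Gal = A₆ and two real roots, compare #C_f(𝔽_p^m) (superelliptic point counting) with
the typed power sums and with
a_p(g)a_p(g') mod 𝔭 for the KW forms predicted from the sextic field (LMFDB mod-3 representations):
a mismatch kills the normalisation (c)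
or the engine's bookkeeping. (3) dim H¹(A₆, L(2) ⊗ 𝔽̄₃) and Thorne-adequacy of Ω₄⁻(3) < GL₄(𝔽̄₃):
non-zero does not kill the route but
redirects the fern away from adequacy-based patching. I could not run these here (plancard seat, no
kit); rev-1 checked the point-count
normalisation numerically at p = 7, 13 for three sextics (all Newton roots of modulus √p).

NUMBERS. |S₆| = 720, |A₆| = 360 = |PSL₂(9)|, |O₄⁻(𝔽₃)| = 1440 = 2·|S₆|; heart = D^(5,1), dim 4,
3-modular irreducibles of A₆ have dimensions
1, 3, 3, 4, 9; genus(C_f) = 4, J(C_f) of dimension 4 with ℤ[ω]-signature (3,1); HT multisets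
(0,1,1,1)/(0,0,0,1); p = 3 = λ² ramified in
K = ℚ(ω), h_K = 1; BCGP 2025: 11743 of 66158 LMFDB genus-2 curves meet their hypotheses (the
analogue census for A₆-sextics with two
real roots is the data item of falsifier (2)).

DEFINITION REQUESTS. (i) ThorneAdequate (Literature/NumberTheory/GaloisRepresentations): adequacy of
a subgroup H ≤ GL_n(k) (Thorne 2012 Def. 2.3 as
amended by Guralnick–Herzig–Taylor–Thorne) — for the informal item HeartAdequate. (ii)
jacobianModPTorsionRep (mod-p Galois module
J(C)[𝔭] of a superelliptic curve) — for the informal support TorsionIsHeart only; nothing typed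
depends on it. Cite facts wanted:
Ramakrishnan2000 Thm M (+ cuspidality criterion), DeligneSerreASENS1974 Lemme 6.11 (lifting),
Mok2014 (endoscopic classification for
unitary groups), HellmannMargerinSchraen2022 main theorem.

Novelty: Searches (2026-08-15, this seat): `lit galaxy search "trigonal curve y^3 Jacobian Galois
representation modularity automorphic unitary
group U(3,1)" --star all` (0 rows); `lit galaxy search "cyclic trigonal curves" --star all` (6 rows:
England–Eilbeck abelian functions,
Eilbeck–Eilers–Enolski arXiv:1305.3201, Cheong arXiv:1603.00672 point distributions — no
automorphy); `lit galaxy search --star pdf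
--mode intelligent "automorphy of the Jacobian of a cyclic trigonal curve … U(3,1) … A6 = PSL(2,9)"`
(8 reranked rows: van Geemen–Schütt
arXiv:1010.3897 order-5 fourfold moduli, Dokchitser–Doris arXiv:1706.06162, Dolgachev–Zarhin notes,
Magma overview — no automorphy
claim); `lit galaxy search` for "classicality irregular weight", "higher Hida theory for unitary",
"eigenvarieties for unitary groups
ramified at p", "overconvergent modular forms on Picard modular surfaces" (0 substring rows each);
`lit read arxiv:2502.20645 --grep
classical` (88 hits; §1.2–1.3 read: the lifting ⇒ p-adic form ⇒ Sen = Cousin classicality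
architecture this route transplants, GSp₄/ℚ,
p = 3 unramified, ordinary); `lit search --source arxiv "trigonal curve Jacobian Galois
representation automorphy"` (0); `lit search --hybrid` (vector leg; FTS leg busy) for "trigonal
genus 4 curve Jacobian unitary Shimura variety automorphy
Galois representation" and "classicality theorem p-adic modular forms irregular weight Sen operator
completed cohomology unitary Shimura
variety" (10 rows each, all textbooks/proceeding  [refs: 10.4171/rmi/1134, 10.1007/s00208-015-1214-z, 10.2307/2661379, 10.1515/crll.1997.488.141, 1305.3201, 1603.00672, 1010.3897, 1706.06162, 2502.20645, 2602.04778, 2603.19768, 1812.09269, arxiv:2502.20645, doi:10.4171/rmi/1134, doi:10.1007/s00208-015-1214-z, doi:10.2307/2661379, doi:10.1515/crll.1997.488.141, Dieulefait2020, Looijenga2023, CasalainamartinJensenLaza2012, BoxerCalegariGeePilloni2025, Box]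

Barriers (technique_class: higher-hida irregular-weight automorphy-lifting): - technique_class: higher-hida irregular-weight automorphy-lifting
- Literature.Barriers.Langlands.NonRegularWeightBarrier: MET head-on and isolated in ONE crux
(SingularWeightClassicality: HT (0,1,1,1) is a repeated weight, the π sought is L-algebraic
non-regular, invisible to Betti cohomology — Scholze 2015 §1). Evasion only along the catalogued
`evasions_known` (coherent cohomology of a Shimura variety in higher degree: higher Hida/Coleman
theory, Pilloni2020 singular weights, BCGP 2025 Sen = Cousin) on the U(3,1) ball quotient;
ThreeAdicLimitAutomorphy and all support items live in regular weight or are weight-free and are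
untouched by it.
- Literature.Barriers.Langlands.TaylorWilesNumericalCoincidence: the lifting/fern step is over the
CM field K for a polarized rank-4 ρ, i.e. on unitary groups U(4)/U(3,1) over ℚ which have Shimura
varieties and defect 0 in regular weight; the irregular point is reached as a LIMIT of regular
classical points (eigenvariety density), never by patching in the defective weight; residual
nuisance ζ₃ ∈ K is named in the crux.
- Literature.Barriers.Langlands.TaylorWilesNumericalCoincidenceNarrow: base ℚ, conjugate-self-dual ρ
over the imaginary quadratic K: inside the narrow form's unitary regime (l₀ = 0), not the GL_n/CM
defect regime.
- Literature.Barriers.Langlands.PatchingLocalComponentBarrier: met at λ: the local deformation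
condition must be trianguline/potentially Barsotti–Tate (HT in {0,1}) rather than a single ordinary
component, since

History (route lifecycle, newest last):
- 2026-08-15T19:34:42Z · rev 2: restated SerreWeakFormAtThree (stmt-Langlands-12743), TwistedTensorResidualAutomorphy (stmt-Langlands-12740) — route-repair (cone guardrail, unit rrepair-Langlands-TrigonalHeartLimit-61a04b95): REROUTED — imports cut to Summits.Langlands.Statement (dropped Literature.Num (planner-rrepair-Langlands-TrigonalHeartLimit-61a04b95-0)
- 2026-08-15T19:36:37Z · rev 3: restated Assembly (stmt-Langlands-12746) — route-repair (cone guardrail) follow-up: Assembly re-pointed at the restated support items OddResidualAutomorphyAtThree / RankinSelbergResidualAutomorphy (the r (planner-rrepair-Langlands-TrigonalHeartLimit-61a04b95-0)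
- 2026-08-16T02:19:14Z · AUTO-CRUX: 1 conjecture-grade item(s) promoted to crux (OddResidualAutomorphyAtThree) — refuter vetting / tiering apply (operator:999:1362873)
- 2026-08-16T16:43:08Z · AUTO-CRUX (backfill): TrigonalJunction — hypotheses of the deciding theorem that nothing in the route derives are cruxes (operator:999:1813213)
- 2026-08-22T13:04:38Z · DORMANT — reconciler: no traction for 5.3 d (last activity item-evidence-added at 2026-08-17T04:06:01Z); parked, not closed — `ledger route dormant route-Langlands-Trigon (operator:999:3620122)
- 2026-08-31T23:11:13Z · REACTIVATED (open) — reconciler: reactivated — activity statement-closed at 2026-08-31T22:06:50Z after parking at 2026-08-22T13:04:38Z (operator:999:959811)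

sub-problem: Langlands · status: open · opened planner-plancard-Langlands-Langlands-trigonal-c3a946cf-g2-0 2026-08-15T18:56:16Z · rev 3 · ledger route-Langlands-TrigonalHeartLimit
GENERATED by the gate from the ledger (D-0016/17). Provers cite these decls: `theorem foo : Summit.Langlands.Langlands.Theses.TrigonalHeartLimit.<Decl> := …` in Summits/Langlands/Langlands/Theorems/<Name>.lean.
-/

namespace Summit.Langlands.Langlands.Theses.TrigonalHeartLimit

open scoped BigOperators Topology Manifold Classical MeasureTheory ProbabilityTheory Matrix InnerProductSpace ComplexConjugate ContinuousMap
open Filter Set Function TopologicalSpace MeasureTheory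

attribute [summit_statement] _root_.Langlands

/-- item stmt-Langlands-12737 · target · rank 0 · open · by planner
why it might fail: False only if reciprocity (B) fails for H¹(C_f)[χ] over ℚ(ω); as TYPED it can fail by normalisation alone (sign/+1 of the cubic sum, σ_K ↔ isotypic piece, m = 1 arithmetic-vs-geometric Frobenius, the non-unitary L-algebraic twist of π) — counts checked only at p = 7, 13 for three sextics (rev 1).
sources: BuzzardGeeLMS2014, DeligneMostow1986, PoonenSchaefer1997, Looijenga2023, Summits/Langlands/Langlands/Ideas/trigonal-heart-psl29-transport.md
[target] X as in § Thesis: for f admissible (f ∈ ℤ[x] monic, deg 6, separable, Nat.card Gal(f) = 360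
(⇔ Gal = A₆), with a non-real root (⇔ exactly two real roots)), ι, σ_K and ρ : Γ_K → GL₄(ℚ̄₃)
trigonal-compatible with f (a.e. v: unramified, Frobenius charpoly arithFrobPolyOfSatake ι q_v 1 α
with Σ_j α_j^[L:k_v] = −σ_K(Σ_{x∈L} χ_L(f(x)) + 1) for every finite L ⊇ k_v, χ_L(u) = the ζ ∈
μ₃(𝓞_K) lifting u^((|L|−1)/3)), there is an L-algebraic cuspidal π on GL₄(𝔸_K), K = CyclotomicField
3 ℚ, with SatakeFrobCompatibleAt ι π ρ v for a.e. v. By Chebotarev + Brauer–Nesbitt such ρ are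
exactly the ρ ≅ ρ_{f,χ} = H¹_et(C_f, ℚ̄₃)[χ] (irreducible since Gal = A₆ acts absolutely irreducibly
on the heart), so X is direction (B) for these motives; non-vacuity is the support item
TrigonalGaloisRepExists. -/
@[route_item "route-Langlands-TrigonalHeartLimit"]
def TrigonalAutomorphy : Prop :=
  ∀ f : Polynomial ℤ, f.Monic → f.natDegree = 6 → (f.map (Int.castRingHom ℚ)).Separable → Nat.card (f.map (Int.castRingHom ℚ)).Gal = 360 → (∃ z ∈ f.rootSet ℂ, z.im ≠ 0) → ∀ (ι : PadicAlgCl 3 ≃+* ℂ) (σK : CyclotomicField 3 ℚ →+* ℂ) (ρ : Literature.NumberTheory.GaloisRepresentations.FramedGaloisRep (CyclotomicField 3 ℚ) (PadicAlgCl 3) 4), (∀ᶠ v : IsDedekindDomain.HeightOneSpectrum (NumberField.RingOfIntegers (CyclotomicField 3 ℚ)) in Filter.cofinite, ∃ α : Multiset ℂ, ρ.IsUnramifiedAt v ∧ ρ.HasFrobCharpolyAt v (Literature.NumberTheory.Automorphic.arithFrobPolyOfSatake ι v.residueCard 1 α) ∧ ∀ (L : Type) [Field L] [Fintype L] [Algebra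 (NumberField.RingOfIntegers (CyclotomicField 3 ℚ) ⧸ v.asIdeal) L], (α.map (· ^ Module.finrank (NumberField.RingOfIntegers (CyclotomicField 3 ℚ) ⧸ v.asIdeal) L)).sum = -(σK (algebraMap (NumberField.RingOfIntegers (CyclotomicField 3 ℚ)) (CyclotomicField 3 ℚ) (∑ x : L, (if h : ∃ ζ : NumberField.RingOfIntegers (CyclotomicField 3 ℚ), ζ ^ 3 = 1 ∧ algebraMap (NumberField.RingOfIntegers (CyclotomicField 3 ℚ) ⧸ v.asIdeal) L (Ideal.Quotient.mk v.asIdeal ζ) = (Polynomial.aeval x f) ^ ((Fintype.card L - 1) / 3) then h.choose else 0))) + 1)) → ∃ (hK : Literature.NumberTheory.Automorphic.isCompact_glFiniteIntegralLevel 4 (CyclotomicField 3 ℚ)) (π : Literature.NumberTheory.Automorphic.CuspidalAutomorphicRepData 4 (CyclotomicField 3 ℚ) hK), π.1.IsLAlgebraic ∧ ∀ᶠ v : IsDedekindDomain.HeightOneSpectrum (NumberField.RingOfIntegers (CyclotomicField 3 ℚ)) in Filter.cofinite, SatakeFrobCompatibleAt ι π.1 ρ v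

/-- item stmt-Langlands-12738 · crux · rank 2 · open · by planner
why it might fail: Known only for ORDINARY GSp4/ℚ (BCGP 2025 §1.3) and GL2 wt 1; here U(3,1)/ℚ(ω), p = 3 RAMIFIED, ρ_f,λ likely non-ordinary, maybe non-trianguline (wild μ₃-cover reduction, BBW 2017 Rem. 2) so on no finite-slope eigenvariety; and the hypothesis bounds no tame level (Π_M of any conductor).
sources: BoxerCalegariGeePilloni2025, arXiv:2502.20645, Pan2022LocallyAnalytic, BoxerPilloni2021, Pilloni2020, BoxerEtAl2021
[crux] CLASSICALITY AT THE SINGULAR WEIGHT (card T3 + the U(3,1) half of T2; BCGP 2025 Thm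
'multiplicity-one-implies-classical' transplanted): for f admissible, ι, σ_K and ρ
trigonal-compatible with f, IF ρ is a uniform 3-adic limit of automorphic Galois representations
over K (∀ M ∃ regular algebraic cuspidal Π_M on GL₄(𝔸_K) and r_M : Γ_K → GL₄(ℚ̄₃) attached to Π_M in
the lang.S27 shape at every v ∤ 3, with ‖tr r_M(σ) − tr ρ(σ)‖ ≤ 3^−M for all σ), THEN ρ is
automorphic: an L-algebraic cuspidal π on GL₄(𝔸_K) with SatakeFrobCompatibleAt ι π ρ v a.e.
Mechanism foreseen: ρ is de Rham with HT (0,1,1,1)/(0,0,0,1) (H¹ of a curve), sits on the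
eigenvariety of the definite U(4) or of the Deligne–Mostow ball quotient U(3,1) (moduli of six
points, Looijenga2023); p-adic Jacquet–Langlands to U(3,1); higher Coleman theory + p-adic
Eichler–Shimura realise ρ in completed coherent cohomology of singular weight; Sen operator = Cousin
map ⇒ de Rham forces classicality (Pan2022LocallyAnalytic, BoxerCalegariGeePilloni2025 §1.3);
transfer U(3,1) → GL₄/K (Mok2014). [deps: ThreeAdicLimitAutomorphy] [difficulty: open-problem] -/
@[route_item "route-Langlands-TrigonalHeartLimit", crux]
def SingularWeightClassicality : Prop :=
  ∀ f : Polynomial ℤ, f.Monic → f.natDegree = 6 → (f.map (Int.castRingHom ℚ)).Separable → Nat.card (f.map (Int.castRingHom ℚ)).Gal = 360 → (∃ z ∈ f.rootSet ℂ, z.im ≠ 0) → ∀ (ι : PadicAlgCl 3 ≃+* ℂ) (σK : CyclotomicField 3 ℚ →+* ℂ) (ρ : Literature.NumberTheory.GaloisRepresentations.FramedGaloisRep (CyclotomicField 3 ℚ) (PadicAlgCl 3) 4), (∀ᶠ v : IsDedekindDomain.HeightOneSpectrum (NumberField.RingOfIntegers (CyclotomicField 3 ℚ)) in Filter.cofinite,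 ∃ α : Multiset ℂ, ρ.IsUnramifiedAt v ∧ ρ.HasFrobCharpolyAt v (Literature.NumberTheory.Automorphic.arithFrobPolyOfSatake ι v.residueCard 1 α) ∧ ∀ (L : Type) [Field L] [Fintype L] [Algebra (NumberField.RingOfIntegers (CyclotomicField 3 ℚ) ⧸ v.asIdeal) L], (α.map (· ^ Module.finrank (NumberField.RingOfIntegers (CyclotomicField 3 ℚ) ⧸ v.asIdeal) L)).sum = -(σK (algebraMap (NumberField.RingOfIntegers (CyclotomicField 3 ℚ)) (CyclotomicField 3 ℚ) (∑ x : L, (if h : ∃ ζ : NumberField.RingOfIntegers (CyclotomicField 3 ℚ), ζ ^ 3 = 1 ∧ algebraMap (NumberField.RingOfIntegers (CyclotomicField 3 ℚ) ⧸ v.asIdeal) L (Ideal.Quotient.mk v.asIdeal ζ) = (Polynomial.aeval x f) ^ ((Fintype.card L - 1) / 3) then h.choose else 0))) + 1)) → (∀ M : ℕ, ∃ (hK : Literature.NumberTheory.Automorphic.isCompact_glFiniteIntegralLevel 4 (CyclotomicField 3 ℚ)) (Pi : Literature.NumberTheory.Automorphic.CuspidalAutomorphicRepData 4 (CyclotomicField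 3 ℚ) hK) (r : Literature.NumberTheory.GaloisRepresentations.FramedGaloisRep (CyclotomicField 3 ℚ) (PadicAlgCl 3) 4), Pi.1.IsRegularAlgebraic ∧ (∀ (v : IsDedekindDomain.HeightOneSpectrum (NumberField.RingOfIntegers (CyclotomicField 3 ℚ))) (α : Multiset ℂ), Pi.1.HasSatakeParamAt v α → ((3 : ℕ) : NumberField.RingOfIntegers (CyclotomicField 3 ℚ)) ∉ v.asIdeal → r.IsUnramifiedAt v ∧ r.HasFrobCharpolyAt v (Literature.NumberTheory.Automorphic.arithFrobPolyOfSatake ι v.residueCard 4 α)) ∧ ∀ σ : Field.absoluteGaloisGroup (CyclotomicField 3 ℚ), ‖Literature.NumberTheory.GaloisRepresentations.FramedRep.trace r σ - Literature.NumberTheory.GaloisRepresentations.FramedRep.trace ρ σ‖ ≤ ((3 : ℝ)⁻¹) ^ M) → ∃ (hK : Literature.NumberTheory.Automorphic.isCompact_glFiniteIntegralLevel 4 (CyclotomicField 3 ℚ)) (π : Literature.NumberTheory.Automorphic.CuspidalAutomorphicRepData 4 (CyclotomicField 3 ℚ) hK), π.1.IsLAlgebraic ∧ ∀ᶠ v :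 IsDedekindDomain.HeightOneSpectrum (NumberField.RingOfIntegers (CyclotomicField 3 ℚ)) in Filter.cofinite, SatakeFrobCompatibleAt ι π.1 ρ v

/-- item stmt-Langlands-12739 · crux · rank 3 · open · by planner
why it might fail: All ferns/liftings in print exclude (ℚ(ζ₃),3): HMS 2022 Thm 1.2 needs F/F⁺ unramified, S and p split; Chenevier 2011 n=3, p split; BLGGT 2.3.1/Thorne/FKP need ζ_p ∉ F or p ≫ n; they give Zariski density, not a 3-adic limit AT ρ, which may be non-trianguline at λ. (Adequacy OK: GHT 2017 Cor 9.4.)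
sources: HellmannMargerinSchraen2022, Chenevier2011, BarnetlambEtAl2014, Thorne2012, GuralnickHerzigTiep2017, arXiv:1904.02374
[crux] THE 3-ADIC FERN AT THE RAMIFIED PRIME (card T2, output form; 'R = T' half of BCGP's
architecture): for f admissible, IF every heart-compatible ρ̄ : G_ℚ → GL₄(k) (k alg. closed, char 3,
discrete; charpoly ρ̄(σ)·(X−1)² = charpoly of σ permuting the six roots) is residually automorphic
over ℚ in regular weight (the conclusion of TwistedTensorResidualAutomorphy verbatim: a regular
algebraic cuspidal Π_ℚ on GL₄(𝔸_ℚ), O ⊆ ℂ, ι : O → k reducing its Hecke polynomials ∏(X −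
q^(3/2)α_j) onto charpoly ρ̄(Frob_v) a.e.), THEN every ρ : Γ_K → GL₄(ℚ̄₃) trigonal-compatible with f
is a uniform 3-adic limit of automorphic Galois representations over K = ℚ(ω) (∀ M ∃ RA cuspidal Π_M
on GL₄(𝔸_K), r_M attached in the lang.S27 shape at all v ∤ 3, ‖tr r_M − tr ρ‖ ≤ 3^−M on Γ_K). Route
inside: reduce ρ (point counts mod λ give ρ̄|_K^ss ≅ heart|_K, elementary: −(S_v+1) ≡ #roots − 2 mod
λ), base-change Π_ℚ to K (ArthurClozelAMS120), descend to a unitary group, put ρ on the eigenvariety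
by an R = T / infinite-fern density theorem (Chenevier2011, HellmannMargerinSchraen2022,
BreuilHellmannSchraen2017Trianguline) and approximate by classical points of regular weight and
small slope. [deps: TwistedTensorR -/
@[route_item "route-Langlands-TrigonalHeartLimit", crux]
def ThreeAdicLimitAutomorphy : Prop :=
  ∀ f : Polynomial ℤ, f.Monic → f.natDegree = 6 → (f.map (Int.castRingHom ℚ)).Separable → Nat.card (f.map (Int.castRingHom ℚ)).Gal = 360 → (∃ z ∈ f.rootSet ℂ, z.im ≠ 0) → (∀ {k : Type} [Field k] [CharP k 3] [IsAlgClosed k] [TopologicalSpace k] [DiscreteTopology k] (ρ : Literature.NumberTheory.GaloisRepresentations.FramedGaloisRep ℚ k 4), (∀ σ : Field.absoluteGaloisGroup ℚ, ((ρ σ : Matrix.GeneralLinearGroup (Fin 4) k) : Matrix (Fin 4) (Fin 4) k).charpoly * (Polynomial.X - 1) ^ 2 = (Matrix.of fun x y : f.rootSet (AlgebraicClosure ℚ) => if σ • (y : AlgebraicClosure ℚ) = (x : AlgebraicClosure ℚ) then (1 : k) else 0).charpoly) → ∃ (hQ : Literature.NumberTheory.Automorphic.isCompact_glFiniteIntegralLevel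 4 ℚ) (PiQ : Literature.NumberTheory.Automorphic.CuspidalAutomorphicRepData 4 ℚ hQ) (O : Subring ℂ) (ι : O →+* k), PiQ.1.IsRegularAlgebraic ∧ ∀ᶠ v : IsDedekindDomain.HeightOneSpectrum (NumberField.RingOfIntegers ℚ) in Filter.cofinite, ∃ (α : Multiset ℂ) (P : Polynomial O), PiQ.1.HasSatakeParamAt v α ∧ P.map O.subtype = (α.map fun a => Polynomial.X - Polynomial.C (((Real.sqrt v.residueCard : ℝ) : ℂ) ^ 3 * a)).prod ∧ ρ.HasFrobCharpolyAt v (P.map ι)) → ∀ (ι : PadicAlgCl 3 ≃+* ℂ) (σK : CyclotomicField 3 ℚ →+* ℂ) (ρ : Literature.NumberTheory.GaloisRepresentations.FramedGaloisRep (CyclotomicField 3 ℚ) (PadicAlgCl 3) 4), (∀ᶠ v : IsDedekindDomain.HeightOneSpectrum (NumberField.RingOfIntegers (CyclotomicField 3 ℚ)) in Filter.cofinite, ∃ α : Multiset ℂ, ρ.IsUnramifiedAt v ∧ ρ.HasFrobCharpolyAt v (Literature.NumberTheory.Automorphic.arithFrobPolyOfSatake ι v.residueCard 1 α) ∧ ∀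 (L : Type) [Field L] [Fintype L] [Algebra (NumberField.RingOfIntegers (CyclotomicField 3 ℚ) ⧸ v.asIdeal) L], (α.map (· ^ Module.finrank (NumberField.RingOfIntegers (CyclotomicField 3 ℚ) ⧸ v.asIdeal) L)).sum = -(σK (algebraMap (NumberField.RingOfIntegers (CyclotomicField 3 ℚ)) (CyclotomicField 3 ℚ) (∑ x : L, (if h : ∃ ζ : NumberField.RingOfIntegers (CyclotomicField 3 ℚ), ζ ^ 3 = 1 ∧ algebraMap (NumberField.RingOfIntegers (CyclotomicField 3 ℚ) ⧸ v.asIdeal) L (Ideal.Quotient.mk v.asIdeal ζ) = (Polynomial.aeval x f) ^ ((Fintype.card L - 1) / 3) then h.choose else 0))) + 1)) → ∀ M : ℕ, ∃ (hK : Literature.NumberTheory.Automorphic.isCompact_glFiniteIntegralLevel 4 (CyclotomicField 3 ℚ)) (Pi : Literature.NumberTheory.Automorphic.CuspidalAutomorphicRepData 4 (CyclotomicField 3 ℚ) hK) (r : Literature.NumberTheory.GaloisRepresentations.FramedGaloisRep (CyclotomicField 3 ℚ) (PadicAlgCl 3) 4), Pi.1.IsRegularAlgebraic ∧ (∀ (v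 : IsDedekindDomain.HeightOneSpectrum (NumberField.RingOfIntegers (CyclotomicField 3 ℚ))) (α : Multiset ℂ), Pi.1.HasSatakeParamAt v α → ((3 : ℕ) : NumberField.RingOfIntegers (CyclotomicField 3 ℚ)) ∉ v.asIdeal → r.IsUnramifiedAt v ∧ r.HasFrobCharpolyAt v (Literature.NumberTheory.Automorphic.arithFrobPolyOfSatake ι v.residueCard 4 α)) ∧ ∀ σ : Field.absoluteGaloisGroup (CyclotomicField 3 ℚ), ‖Literature.NumberTheory.GaloisRepresentations.FramedRep.trace r σ - Literature.NumberTheory.GaloisRepresentations.FramedRep.trace ρ σ‖ ≤ ((3 : ℝ)⁻¹) ^ M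

/-- item stmt-Langlands-12745 · crux (kind.auto-crux: conjecture-grade) · rank 9 · open · by planner
why it might fail: auto-crux — summit-strength (notes:refuter-refute-pool-g43-5): the deciding theorem assumes it and nothing in the route derives it, so it is a bet, not glue
sources: BuzzardGeeLMS2014, FontaineMazurGeometric1995
[support] THE REST OF THE SUMMIT: automorphy of the trigonal U(3,1) family (X) ⇒ Langlands (all
other n, F, ρ, direction (A), local–global compatibility at every place, upgrade of a.e. Satake
matching to Corresponds). Not this route's business; filed so that `closes` ends in the summit
constant (house pattern of the conforming routes, e.g. ImQuadArtinJunction); shared junction for the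
three μ₃-cover ball-quotient cards (Picard U(2,1), this U(3,1), cubic surfaces U(4,1)) once their
targets are typed in the same Satake–Frobenius form. [difficulty: open-problem] -/
@[route_item "route-Langlands-TrigonalHeartLimit", crux]
def TrigonalJunction : Prop :=
  TrigonalAutomorphy → _root_.Langlands

/-- item stmt-Langlands-13672 · crux (kind.auto-crux: conjecture-grade) · rank 9 · open · by planner
why it might fail: auto-crux — conjecture-grade statement (docstring avows it ('CONJECTURE')); it is open, so it may simply be false
sources: KhareWintenberger2009, Kisin2009TwoAdic, DeligneSerreASENS1974
[support] SERRE'S CONJECTURE AT p = 3 IN THE SUMMIT'S AUTOMORPHIC IDIOM (theorem of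
Khare–Wintenberger–Kisin; rev 1, route-repair 2026-08-15: supersedes rev-0 SerreWeakFormAtThree,
which inlined the NEWFORM-language body of the tree fact
`Literature.NumberTheory.Automorphic.exists_newform_of_odd_irreducible (p := 3)` and thereby forced
`import Literature.NumberTheory.EllipticCurves.NewformGaloisRep` = 16 unproved, unused named facts
in the import cone): for k algebraically closed of characteristic 3 (discrete) and every irreducible
ODD τ : G_ℚ → GL₂(k) there are a regular algebraic cuspidal π on GL₂(𝔸_ℚ), a subring O ⊆ ℂ and ι : O
→+* k such that for a.e. finite v the HLTT-normalised Hecke polynomial ∏_j (X − q_v^(1/2) α_j) (α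
the Satake parameter of π_v) lies in O[X] and reduces along ι to charpoly τ(Frob_v) (arithmetic
Frobenius, `HasFrobCharpolyAt`) — the n = 2 case of the residual-automorphy clause used at n = 4 by
RankinSelbergResidualAutomorphy / ThreeAdicLimitAutomorphy, and verbatim the hypothesis
RankinSelbergResidualAutomorphy consumes at p = 3 in `closes`. In print: KW(3) gives a newform g ∈
S_w(Γ₁(N)), w = k(τ) ≥ 2, 3 ∤ N, with ρ̄_g ≅ τ; π = the automorphic representati -/
@[route_item "route-Langlands-TrigonalHeartLimit", crux]
def OddResidualAutomorphyAtThree : Prop :=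
  ∀ {k : Type} [Field k] [CharP k 3] [IsAlgClosed k] [TopologicalSpace k] [DiscreteTopology k] (τ : Literature.NumberTheory.GaloisRepresentations.FramedGaloisRep ℚ k 2), τ.toGaloisRep.IsIrreducible → Literature.NumberTheory.GaloisRepresentations.FramedGaloisRep.IsOdd τ → ∃ (hQ : Literature.NumberTheory.Automorphic.isCompact_glFiniteIntegralLevel 2 ℚ) (πQ : Literature.NumberTheory.Automorphic.CuspidalAutomorphicRepData 2 ℚ hQ) (O : Subring ℂ) (ι : O →+* k), πQ.1.IsRegularAlgebraic ∧ ∀ᶠ v : IsDedekindDomain.HeightOneSpectrum (NumberField.RingOfIntegers ℚ) in Filter.cofinite, ∃ (α : Multiset ℂ) (P : Polynomial O), πQ.1.HasSatakeParamAt v α ∧ P.map O.subtype = (α.map fun a => Polynomial.X - Polynomial.C (((Real.sqrt v.residueCard : ℝ) : ℂ) * a)).prod ∧ τ.HasFrobCharpolyAt v (P.map ι)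

/-- item stmt-Langlands-12741 · support · rank 9 · closed · proved by Summit.Langlands.Langlands.Theorems.TrigonalHeartLimitHeartTwistedTensor.heartTwistedTensor (prover) · by planner
sources: JamesKerber1981, James1978, Mortimer1980, Gorenstein1982
[support] THE TRANSPORT, finite and decidable (rev-1 r4 verbatim): ∃ φ : SL₂(𝔽₉) →* S₆ with image
A₆, ψ ≠ id a ring endomorphism of 𝔽₉, e : Fin 2 × Fin 2 ≃ Fin 4 and invertible P ∈ M₄(𝔽₉) with M(φ
g)·P = P·reindex_e(g ⊗ g^ψ) for all g, where M(σ) is the explicit matrix of σ on the heart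
(sum-zero/constants) of 𝔽₃[six points] in the basis [e_j − e_5]. A₆ ≅ PSL₂(9) ≅ Ω₄⁻(3); heart =
D^(5,1) = W ⊗ W^(3) (James1978 Ex. 5.1/17.1, Gorenstein1982 (2.7)). Certified computation or
character theory. [difficulty: provable-now] -/
@[route_item "route-Langlands-TrigonalHeartLimit", crux]
def HeartTwistedTensor : Prop :=
  ∃ (φ : Matrix.SpecialLinearGroup (Fin 2) (GaloisField 3 2) →* Equiv.Perm (Fin 6)) (ψ : GaloisField 3 2 →+* GaloisField 3 2) (e : Fin 2 × Fin 2 ≃ Fin 4) (P : Matrix (Fin 4) (Fin 4) (GaloisField 3 2)), φ.range = alternatingGroup (Fin 6) ∧ ψ ≠ RingHom.id (GaloisField 3 2) ∧ IsUnit P.det ∧ ∀ g : Matrix.SpecialLinearGroup (Fin 2) (GaloisField 3 2), (Matrix.of fun i j : Fin 4 => ((if ((φ g (Fin.castAdd 2 j) : Fin 6) : ℕ) = (i : ℕ) then 1 else if ((φ g (Fin.castAdd 2 j) : Fin 6) : ℕ) = 4 then -1 else 0) - (if ((φ g (Fin.last 5) : Fin 6) : ℕ) = (i : ℕ) then 1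 else if ((φ g (Fin.last 5) : Fin 6) : ℕ) = 4 then -1 else 0) : GaloisField 3 2)) * P = P * Matrix.reindex e e (Matrix.kronecker (g : Matrix (Fin 2) (Fin 2) (GaloisField 3 2)) ((g : Matrix (Fin 2) (Fin 2) (GaloisField 3 2)).map ψ))

-- `HeartTwistedTensor` holds: proved by `Summit.Langlands.Langlands.Theorems.TrigonalHeartLimitHeartTwistedTensor.heartTwistedTensor` (its module imports this route file, so no `_holds` link can be stated here).

/-- item stmt-Langlands-12742 · support · rank 9 · open · by planner
sources: SerreDurham1977, Buhler1978, KhareWintenberger2009, JamesKerber1981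
[support] GALOIS TRANSPORT (rev-1 r5 verbatim): HeartTwistedTensor ⟹ for f admissible and every
heart-compatible ρ̄ : G_ℚ → GL₄(k) there are τ : G_ℚ → GL₂(k) irreducible and ODD, ψ : k →+* k, χ, e
with charpoly ρ̄(σ) = charpoly(reindex_e(det χ(σ)·τ(σ) ⊗ τ(σ)^ψ)) for all σ, and ρ̄ is irreducible.
Tate lifting of G_ℚ → A₆ ≅ PSL₂(9) → PGL₂(k) (SerreDurham1977 §6, H²(G_ℚ, k^×)-lifting); oddness: c²
= 1 forces τ̃(c) = ±i·g with g² = −1, eigenvalues ±1, det = −1, as soon as c moves a root.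
[difficulty: M] -/
@[route_item "route-Langlands-TrigonalHeartLimit", crux]
def GaloisTransport : Prop :=
  HeartTwistedTensor → ∀ f : Polynomial ℤ, f.Monic → f.natDegree = 6 → (f.map (Int.castRingHom ℚ)).Separable → Nat.card (f.map (Int.castRingHom ℚ)).Gal = 360 → (∃ z ∈ f.rootSet ℂ, z.im ≠ 0) → ∀ {k : Type} [Field k] [CharP k 3] [IsAlgClosed k] [TopologicalSpace k] [DiscreteTopology k] (ρ : Literature.NumberTheory.GaloisRepresentations.FramedGaloisRep ℚ k 4), (∀ σ : Field.absoluteGaloisGroup ℚ, ((ρ σ : Matrix.GeneralLinearGroup (Fin 4) k) : Matrix (Fin 4) (Fin 4) k).charpoly * (Polynomial.X - 1) ^ 2 = (Matrix.of fun x y : f.rootSet (AlgebraicClosure ℚ) => if σ • (y : AlgebraicClosure ℚ) = (x : AlgebraicClosure ℚ) then (1 : k) else 0).charpoly) → ∃ (τ : Literature.NumberTheory.GaloisRepresentations.FramedGaloisRep ℚ k 2) (ψ : k →+* k) (χ : Literature.NumberTheory.GaloisRepresentations.FramedGaloisRep ℚ k 1) (e : Fin 2 × Fin 2 ≃ Fin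 4), τ.toGaloisRep.IsIrreducible ∧ Literature.NumberTheory.GaloisRepresentations.FramedGaloisRep.IsOdd τ ∧ (∀ σ : Field.absoluteGaloisGroup ℚ, ((ρ σ : Matrix.GeneralLinearGroup (Fin 4) k) : Matrix (Fin 4) (Fin 4) k).charpoly = (Matrix.reindex e e ((Matrix.GeneralLinearGroup.det (χ σ) : k) • Matrix.kronecker ((τ σ : Matrix.GeneralLinearGroup (Fin 2) k) : Matrix (Fin 2) (Fin 2) k) (((τ σ : Matrix.GeneralLinearGroup (Fin 2) k) : Matrix (Fin 2) (Fin 2) k).map ψ))).charpoly) ∧ ρ.toGaloisRep.IsIrreducible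

/-- item stmt-Langlands-12744 · support · rank 9 · open · by planner
sources: PoonenSchaefer1997, DeligneMostow1986, Sutherland2012
[support] NON-VACUITY GUARD (not a hypothesis of closes; known: Weil 1948 + Tate module + the
ℤ[ω]-isotypic decomposition of H¹_et(C_f, ℚ̄₃) over K): for every monic separable sextic f ∈ ℤ[x], ι
and σ_K there is a ρ : Γ_K → GL₄(ℚ̄₃) trigonal-compatible with f (same clause as in the target). A
refuter who finds the clause unsatisfiable for one f (numerically: power sums at p = 7, 13, 19 not
those of a weight-1 rank-4 Frobenius) has found a normalisation slip in the whole route — restate,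
do not close. [difficulty: XL] -/
@[route_item "route-Langlands-TrigonalHeartLimit"]
def TrigonalGaloisRepExists : Prop :=
  ∀ f : Polynomial ℤ, f.Monic → f.natDegree = 6 → (f.map (Int.castRingHom ℚ)).Separable → ∀ (ι : PadicAlgCl 3 ≃+* ℂ) (σK : CyclotomicField 3 ℚ →+* ℂ), ∃ ρ : Literature.NumberTheory.GaloisRepresentations.FramedGaloisRep (CyclotomicField 3 ℚ) (PadicAlgCl 3) 4, ∀ᶠ v : IsDedekindDomain.HeightOneSpectrum (NumberField.RingOfIntegers (CyclotomicField 3 ℚ)) in Filter.cofinite, ∃ α : Multiset ℂ, ρ.IsUnramifiedAt v ∧ ρ.HasFrobCharpolyAt v (Literature.NumberTheory.Automorphic.arithFrobPolyOfSatake ι v.residueCard 1 α) ∧ ∀ (L : Type) [Field L] [Fintype L] [Algebra (NumberField.RingOfIntegers (CyclotomicField 3 ℚ) ⧸ v.asIdeal) L], (α.map (· ^ Module.finrank (NumberField.RingOfIntegers (CyclotomicField 3 ℚ) ⧸ v.asIdeal) L)).sum = -(σK (algebraMap (NumberField.RingOfIntegers (CyclotomicField 3 ℚ)) (CyclotomicField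 3 ℚ) (∑ x : L, (if h : ∃ ζ : NumberField.RingOfIntegers (CyclotomicField 3 ℚ), ζ ^ 3 = 1 ∧ algebraMap (NumberField.RingOfIntegers (CyclotomicField 3 ℚ) ⧸ v.asIdeal) L (Ideal.Quotient.mk v.asIdeal ζ) = (Polynomial.aeval x f) ^ ((Fintype.card L - 1) / 3) then h.choose else 0))) + 1)

-- item stmt-Langlands-13637 · support · rank 9 · open · by planner — informal only, no Lean statement yet:
--   [support] HEART ADEQUACY AT p = 3 (decidable finite-group check sitting under crux
--   ThreeAdicLimitAutomorphy; informal until the definition request ThorneAdequate lands, then typed by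
--   a grounder): the image of G_K, K = Q(omega), on the heart — A6 = PSL2(9) = Omega4^-(3) <
--   GL4(F3-bar), acting through D^(5,1) = W (x) W^(3) — is ADEQUATE in the sense of Thorne 2012 Def. 2.3
--   as amended by Guralnick–Herzig–Taylor–Thorne: H^1(A6, k) = 0 (A6 perfect), H^0(A6, ad^0) = 0 (3 does
--   not divide 4; absolutely irreducible), H^1(A6, ad^0) = 0 where ad^0 = L(2) + L(2)^(3) + St
--   (dimensions 3 + 3 + 9; St = L(2) (x

/-- item stmt-Langlands-13673 · support · rank 9 · open · by planner
sources: Ramakrishnan2000, DeligneSerreASENS1974, KhareWintenberger2009, Dieulefait2020, Ramakrishnan2002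
[support] THE ENGINE: RANKIN–SELBERG TRANSFER OF RESIDUAL AUTOMORPHY GL₂ → GL₄ (known in print,
hence support; rev 1, route-repair 2026-08-15: supersedes rev-0 TwistedTensorResidualAutomorphy —
same conclusion VERBATIM, but the blanket Serre hypothesis in newform language is replaced by the
POINTWISE residual automorphy of τ in the summit's automorphic idiom, so no newform constants and no
Serre hypothesis remain): for every prime p and algebraically closed discrete k of characteristic p,
if τ : G_ℚ → GL₂(k) is irreducible, odd and residually automorphic of regular weight (∃ RA cuspidal
π on GL₂(𝔸_ℚ), O ⊆ ℂ, ι : O → k with ∏(X − q^(1/2)α_j) ∈ O[X] reducing along ι to charpoly τ(Frob_v)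
a.e.), ψ : k →+* k, χ : G_ℚ → GL₁(k), e : Fin 2 × Fin 2 ≃ Fin 4, and ρ̄ : G_ℚ → GL₄(k) is
irreducible with charpoly ρ̄(σ) = charpoly(reindex_e(det χ(σ)·τ(σ) ⊗ τ(σ)^ψ)) for all σ, then ρ̄ is
residually automorphic on GL₄/ℚ in regular weight: ∃ RA cuspidal Π on GL₄(𝔸_ℚ), O′ ⊆ ℂ, ι′ : O′ → k
with ι′(∏(X − q^(3/2)α_j)) = charpoly ρ̄(Frob_v) a.e. (verbatim the hypothesis of the crux
ThreeAdicLimitAutomorphy). In print: π ↔ newform g of weight w ≥ 2 (RA cuspidal on GL₂/ℚ ⇔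
holomorphic of weight ≥ 2); τ^ψ i -/
@[route_item "route-Langlands-TrigonalHeartLimit", crux]
def RankinSelbergResidualAutomorphy : Prop :=
  ∀ (p : ℕ) [Fact p.Prime] {k : Type} [Field k] [CharP k p] [IsAlgClosed k] [TopologicalSpace k] [DiscreteTopology k] (τ : Literature.NumberTheory.GaloisRepresentations.FramedGaloisRep ℚ k 2) (ψ : k →+* k) (χ : Literature.NumberTheory.GaloisRepresentations.FramedGaloisRep ℚ k 1) (e : Fin 2 × Fin 2 ≃ Fin 4) (ρ : Literature.NumberTheory.GaloisRepresentations.FramedGaloisRep ℚ k 4), τ.toGaloisRep.IsIrreducible → Literature.NumberTheory.GaloisRepresentations.FramedGaloisRep.IsOdd τ → (∃ (hQ : Literature.NumberTheory.Automorphic.isCompact_glFiniteIntegralLevel 2 ℚ) (πQ : Literature.NumberTheory.Automorphic.CuspidalAutomorphicRepData 2 ℚ hQ) (O : Subring ℂ) (ι : O →+* k), πQ.1.IsRegularAlgebraic ∧ ∀ᶠ v : IsDedekindDomain.HeightOneSpectrum (NumberField.RingOfIntegers ℚ) in Filter.cofinite, ∃ (α : Multiset ℂ) (P : Polynomial O),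 πQ.1.HasSatakeParamAt v α ∧ P.map O.subtype = (α.map fun a => Polynomial.X - Polynomial.C (((Real.sqrt v.residueCard : ℝ) : ℂ) * a)).prod ∧ τ.HasFrobCharpolyAt v (P.map ι)) → (∀ σ : Field.absoluteGaloisGroup ℚ, ((ρ σ : Matrix.GeneralLinearGroup (Fin 4) k) : Matrix (Fin 4) (Fin 4) k).charpoly = (Matrix.reindex e e ((Matrix.GeneralLinearGroup.det (χ σ) : k) • Matrix.kronecker ((τ σ : Matrix.GeneralLinearGroup (Fin 2) k) : Matrix (Fin 2) (Fin 2) k) (((τ σ : Matrix.GeneralLinearGroup (Fin 2) k) : Matrix (Fin 2) (Fin 2) k).map ψ))).charpoly) → ρ.toGaloisRep.IsIrreducible → ∃ (hQ : Literature.NumberTheory.Automorphic.isCompact_glFiniteIntegralLevel 4 ℚ) (PiQ : Literature.NumberTheory.Automorphic.CuspidalAutomorphicRepData 4 ℚ hQ) (O : Subring ℂ) (ι : O →+* k), PiQ.1.IsRegularAlgebraic ∧ ∀ᶠ v : IsDedekindDomain.HeightOneSpectrum (NumberField.RingOfIntegers ℚ) in Filter.cofinite, ∃ (α : Multiset ℂ)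 (P : Polynomial O), PiQ.1.HasSatakeParamAt v α ∧ P.map O.subtype = (α.map fun a => Polynomial.X - Polynomial.C (((Real.sqrt v.residueCard : ℝ) : ℂ) ^ 3 * a)).prod ∧ ρ.HasFrobCharpolyAt v (P.map ι)

-- item stmt-Langlands-13772 · support · rank 9 · open · by planner — informal only, no Lean statement yet:
--   [support] TORSION IS THE HEART (geometric input; informal until a Jacobian / torsion Galois-module
--   notion lands — definition request jacobianModPTorsionRep filed by rev 1; nothing typed depends on
--   it): for f in Q[x] squarefree of degree 6 and C_f : y^3 = f(x) (smooth projective model, genus 4,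
--   the three points at infinity unramified since 3 | 6), with omega acting by (x, y) -> (x, omega y)
--   and lambda = 1 - omega: J(C_f)[lambda] is G_Q-stable (lambda and its conjugate are associate) and
--   isomorphic as an F3[G_Q]-module to the HEART {a in F3^roots : sum a = 0} / F3.(1,...,1) of the
--   permutation mo

-- earlier Assembly (stmt-Langlands-12746, replaced 2026-08-15T19:36:37Z -> stmt-Langlands-13694): retired by None — SerreWeakFormAtThree → TwistedTensorResidualAutomorphy → HeartTwistedTensor → GaloisTransport → ThreeAdicLimitAutomorphy → SingularWeightClassicality → TrigonalJunction → _root_.Langlands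
/-- item stmt-Langlands-13694 · assembly · rank 1 · open · by planner
sources: BoxerCalegariGeePilloni2025, KhareWintenberger2009, Summits/Langlands/Langlands/Ideas/trigonal-heart-psl29-transport.md
[assembly] OddResidualAutomorphyAtThree → RankinSelbergResidualAutomorphy → HeartTwistedTensor →
GaloisTransport → ThreeAdicLimitAutomorphy → SingularWeightClassicality → TrigonalJunction →
Langlands (rev 3: the chain re-pointed at the two restated support items; it is exactly the type of
the deciding theorem `closes`, which proves it by 8 lines of logic). -/
@[route_item "route-Langlands-TrigonalHeartLimit"]
def Assembly : Prop :=
  OddResidualAutomorphyAtThree → RankinSelbergResidualAutomorphy → HeartTwistedTensor → GaloisTransport → ThreeAdicLimitAutomorphy → SingularWeightClassicality → TrigonalJunction → _root_.Langlands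

-- records of items no longer active in this route (dropped / restated):
-- earlier TwistedTensorResidualAutomorphy (stmt-Langlands-12740, replaced 2026-08-15T19:34:42Z -> stmt-Langlands-13673): retired by None — ∀ (p : ℕ) [Fact p.Prime] {k : Type} [Field k] [CharP k p] [IsAlgClosed k] [TopologicalSpace k] [DiscreteTopology k], (∀ (τ₀ : Literature.NumberTheory.GaloisRepresentations.FramedGaloisRep ℚ k 2), τ₀.toGaloisRep.IsIrreducible → Literature.NumberTheory.GaloisRepres
-- earlier SerreWeakFormAtThree (stmt-Langlands-12743, replaced 2026-08-15T19:34:42Z -> stmt-Langlands-13672): retired by None — ∀ {k : Type} [Field k] [CharP k 3] [IsAlgClosed k] [TopologicalSpace k] [DiscreteTopology k], ∀ (τ₀ : Literature.NumberTheory.GaloisRepresentations.FramedGaloisRep ℚ k 2), τ₀.toGaloisRep.IsIrreducible → Literature.NumberTheory.GaloisRepresentations.FramedGaloisRep.IsOdd τ₀ 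

/-! D-0027 §2.1 — DECIDING THEOREM (planner-authored via `route open/edit --closes-file`; by planner-rrepair-Langlands-TrigonalHeartLimit-61a04b95-0 2026-08-15T19:34:42Z):
its hypotheses are this route's items and its conclusion the sub-problem Statement (glue_lint), and it elaborates with this file. -/

@[closes "route-Langlands-TrigonalHeartLimit"] theorem closes (hKW : OddResidualAutomorphyAtThree) (hRS : RankinSelbergResidualAutomorphy)
    (hH : HeartTwistedTensor) (hG : GaloisTransport) (hA : ThreeAdicLimitAutomorphy)
    (hB : SingularWeightClassicality) (hJ : TrigonalJunction) : _root_.Langlands := by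
  refine hJ ?_
  intro f hmon hdeg hsep hgal hreal ι σK ρ hρ
  refine hB f hmon hdeg hsep hgal hreal ι σK ρ hρ ?_
  refine hA f hmon hdeg hsep hgal hreal ?_ ι σK ρ hρ
  intro k _ _ _ _ _ ρbar hheart
  obtain ⟨τ, ψ, χ, e, hτ, hodd, hTTid, hirr⟩ := hG hH f hmon hdeg hsep hgal hreal ρbar hheart
  exact hRS 3 τ ψ χ e ρbar hτ hodd (hKW τ hτ hodd) hTTid hirr

end Summit.Langlands.Langlands.Theses.TrigonalHeartLimit
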